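import Summits.Ventures.HSemireg.UntwistCocycleTwistWedgeTrace
import Summits.Ventures.HSemireg.UntwistCocycleTwistDualHomNaturalityLeft
import Summits.Ventures.HSemireg.HigherSigmaOfIso
import Summits.Ventures.HSemireg.CocycleExtension
import HarnessLib

/-!
# Venture HSemireg — route R1.0, untwisted reading: the local jet comparison `α_x : Pʲ(E)⟨c⟩|_{U_x} → Pʲ(E⟨c⟩)|_{U_x}`
# and its overlap cocycle `dlog g_{xy} ∧ –` (gs-g4 gen 21, brick C5a = input of the extension-comparison lemma)

HONEST FRAMING. Module-level sheaf algebra on the tree's REAL carriers (th-4's cocycle twist `E⟨c⟩ = E ⊗ M`, the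
`Ωʲ`-twisted jet module `Pʲ(E)` of `HodgeTheory/SemiregularityHigherSigma`, gen-19's `λ_j = dualHomTwist` and
`J^j_x = jetTwistOverHigher`). It restates gen-20's level-`j` Leibniz cocycle identity
(`UntwistCocycleTwistLeibnizCocycleHigher`) in the MORPHISM form consumed by the extension-comparison lemma
(`CocycleExtensionCompareDerived`). Nothing about any variety; nothing here says HC, HC_CM or HC_AV is proved.

## Contents (everything proved)

* `dlogWedgeCocycle c j F : LocalOneCocycle c (F ⊗ Ωʲ) (F ⊗ Ωʲ⁺¹)` — the local `1`-cocycle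
  `ψ ↦ ψ ≫ ((-ω_{xy}) ∧ –)`, `ω_{xy} = dlogForm c x y` (restriction: `map_dlogForm`; cocycle: `dlogForm_cocycle`).
* `jetCompare c E j x = t_x⁻¹ ≫ J^j_x : Pʲ(E)⟨c⟩|_{U_x} ⟶ Pʲ(E⟨c⟩)|_{U_x}` and
  - `jetCompare_π` : `α_x ≫ π′_j| = (π_j⟨c⟩ ≫ λ_j)|`;
  - `ι_jetCompare` : `ι_j⟨c⟩| ≫ α_x = λ_{j+1}| ≫ ι′_j|`;
  - **`jetCompare_sub`** : `α_y| - α_x| = (π_j⟨c⟩ ≫ λ_j)| ≫ w_{xy} ≫ ι′_j|` on `V ⊆ U_x ∩ U_y`, `w = dlogWedgeCocycle`;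
  - `jetCompare_naturality` : `α_x` is natural in the module `E`.

## References

* [Ati57] M. F. Atiyah, *Complex analytic connections in fibre bundles*, Trans. AMS 85 (1957), §4, Prop. 12.
-/

noncomputable section

set_option backward.isDefEq.respectTransparency false

open CategoryTheory AlgebraicGeometry Opposite TopologicalSpace

namespace Summit.Ventures.HSemireg

namespace CocycleTwist

open Literature.AlgebraicGeometry.Modules Literature.AlgebraicGeometry.Motives
  Literature.AlgebraicGeometry.HodgeTheory

universe u

variable {S : Type u} [CommRing S] {X : Over (Spec (CommRingCat.of S))} (c : UnitCocycle X.left)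
  (E : X.left.Modules) (j : ℕ)

/-! ### The `dlog`-wedge cocycle -/

section Cocycle

variable {A B B' : X.left.Modules} {W : X.left.Opens}

/-- `ψ ↦ ψ ≫ (t + t′)` is `(ψ ↦ ψ ≫ t) + (ψ ↦ ψ ≫ t′)`. [folklore] -/
theorem postcompOver_add' (t t' : B.over W ⟶ B'.over W) :
    postcompOver A (t + t') = postcompOver A t + postcompOver A t' :=
  hom_ext_of_appLE fun V k (ψ : A.over V ⟶ B.over V) => by
    rw [appLE_add, appLE_postcompOver, appLE_postcompOver, appLE_postcompOver, restrictHom_add, Preadditive.comp_add]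

variable (F : X.left.Modules)

/-- `ω_{xz} = ω_{xy} + ω_{yz}` for `ω = dlogForm c`. [cite: Atiyah1957, Prop. 12] -/
theorem dlogForm_add (x y z : X.left) (V : X.left.Opens) (hx : V ≤ c.U x) (hy : V ≤ c.U y) (hz : V ≤ c.U z) :
    dlogForm c x z V hx hz = dlogForm c x y V hx hy + dlogForm c y z V hy hz := by
  have h := dlogForm_cocycle c x y z V hx hy hz
  rw [← sub_eq_zero]
  have h' : dlogForm c x z V hx hz - (dlogForm c x y V hx hy + dlogForm c y z V hy hz) =
      -(dlogForm c y z V hy hz - dlogForm c x z V hx hz + dlogForm c x y V hx hy) := by abel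
  rw [h', h, neg_zero]

/-- **The `dlog`-wedge cocycle** `w_{xy} : ψ ↦ ψ ≫ ((-ω_{xy}) ∧ –)` on `F ⊗ Ωʲ → F ⊗ Ωʲ⁺¹`, `ω_{xy} = dlogForm c x y`
(a local `1`-cocycle along the cover of `c`). [cite: Atiyah1957, Prop. 12] -/
def dlogWedgeCocycle : LocalOneCocycle c (twistHodge F j) (twistHodge F (j + 1)) where
  w x y V hx hy := postcompOver (dual F) (wedgeHomAt j (-(dlogForm c x y V hx hy)))
  restrictHom_w := by
    intro x y V W hx hy i
    rw [restrictHom_postcompOver', restrictHom_wedgeHomAt, map_neg, map_dlogForm]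
  w_cocycle x y z V hx hy hz := by
    rw [dlogForm_add c x y z V hx hy hz, neg_add, wedgeHomAt_add, postcompOver_add']

/-- Components of the `dlog`-wedge cocycle. [folklore] -/
theorem dlogWedgeCocycle_w (x y : X.left) (V : X.left.Opens) (hx : V ≤ c.U x) (hy : V ≤ c.U y) :
    (dlogWedgeCocycle c j F).w x y V hx hy = postcompOver (dual F) (wedgeHomAt j (-(dlogForm c x y V hx hy))) := rfl

end Cocycle

/-! ### The local jet comparison `α_x = t_x⁻¹ ≫ J^j_x` -/

/-- **`α_x : Pʲ(E)⟨c⟩|_{U_x} ⟶ Pʲ(E⟨c⟩)|_{U_x}`**, `α_x = t_x⁻¹ ≫ J^j_x`: untwist by the local frame `t_x` of `M`, then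
gen-19's jet comparison `(φ, ψ) ↦ (λ_j(φ ⊗ t_x), λ_{j+1}(ψ ⊗ t_x))`. [cite: Atiyah1957, §4] -/
def jetCompare (x : X.left) :
    (twist c (twistJetModule E j)).over (c.U x) ⟶ (twistJetModule (twist c E) j).over (c.U x) :=
  ofTwistOver c (twistJetModule E j) x (c.U x) le_rfl ≫ jetTwistOverHigher c E j x (c.U x) le_rfl

/-- Values of `α_x`: `J^j_x` of the `x`-coordinate. [folklore] -/
theorem appLE_jetCompare (x : X.left) {V : X.left.Opens} (k : V ⟶ c.U x)
    (s : Γ(twist c (twistJetModule E j), V)) :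
    appLE (jetCompare c E j x) k s =
      (jetTwistFunHigher c E j x k.le (coordAt c (twistJetModule E j) x k.le s : TwistJetSections E j V) :
        Γ(twistJetModule (twist c E) j, V)) := rfl

/-- **`α_x ≫ π′_j| = (π_j⟨c⟩ ≫ λ_j)|`.** [folklore] -/
theorem jetCompare_π (x : X.left) :
    jetCompare c E j x ≫ (SheafOfModules.overFunctor _ (c.U x)).map (twistJetπ (twist c E) j) =
      (SheafOfModules.overFunctor _ (c.U x)).map (twistMap c (twistJetπ E j)) ≫
        (SheafOfModules.overFunctor _ (c.U x)).map (dualHomTwist c E (hodgeSheaf X j)) := by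
  refine hom_ext_of_appLE fun V k s => ?_
  rw [appLE_comp, appLE_over_map, appLE_jetCompare, twistJetπ_app_apply, jetTwistFunHigher_fst, appLE_comp,
    appLE_over_map, appLE_over_map]
  conv_rhs => rw [← trivSection_coordAt c (twistJetModule E j) x k.le s, twistMap_app_trivSection]
  rfl

/-- **`ι_j⟨c⟩| ≫ α_x = λ_{j+1}| ≫ ι′_j|`.** [folklore] -/
theorem ι_jetCompare (x : X.left) :
    (SheafOfModules.overFunctor _ (c.U x)).map (twistMap c (twistJetι E j)) ≫ jetCompare c E j x =
      (SheafOfModules.overFunctor _ (c.U x)).map (dualHomTwist c E (hodgeSheaf X (j + 1))) ≫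
        (SheafOfModules.overFunctor _ (c.U x)).map (twistJetι (twist c E) j) := by
  refine hom_ext_of_appLE fun V k ψ => ?_
  rw [appLE_comp, appLE_over_map, appLE_jetCompare, appLE_comp, appLE_over_map, appLE_over_map, twistJetι_app_apply]
  conv_lhs => rw [← trivSection_coordAt c (twistHodge E (j + 1)) x k.le ψ, twistMap_app_trivSection, coordAt_trivSection]
  refine TwistJetSections.ext ?_ ?_
  · rw [jetTwistFunHigher_fst, TwistJetSections.fst_mk]
    change (dualHomTwist c E (hodgeSheaf X j)).app V (trivSection c (twistHodge E j) x _
      (TwistJetSections.fst ((twistJetι E j).app V _ : TwistJetSections E j V))) = 0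
    rw [twistJetι_app_apply, TwistJetSections.fst_mk]
    change (dualHomTwist c E (hodgeSheaf X j)).app V (trivSection c (twistHodge E j) x _ 0) = 0
    rw [trivSection_zero, map_zero]
  · rw [jetTwistFunHigher_snd, TwistJetSections.snd_mk]
    change (dualHomTwist c E (hodgeSheaf X (j + 1))).app V (trivSection c (twistHodge E (j + 1)) x _
      (TwistJetSections.snd ((twistJetι E j).app V _ : TwistJetSections E j V))) = _
    rw [twistJetι_app_apply, TwistJetSections.snd_mk, trivSection_coordAt]

/-- **The overlap identity on sections**: `α_y(s) - α_x(s) = ι′_j(-(λ_j(π⟨c⟩ s) ≫ (ω_{xy} ∧ –)))` over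
`V ⊆ U_x ∩ U_y` (gen-20's Leibniz cocycle identity, morphism-free form). [cite: Atiyah1957, §4 and Prop. 12] -/
theorem appLE_jetCompare_sub {V : X.left.Opens} (x y : X.left) (kx : V ⟶ c.U x) (ky : V ⟶ c.U y)
    (s : Γ(twist c (twistJetModule E j), V)) :
    appLE (jetCompare c E j y) ky s - appLE (jetCompare c E j x) kx s =
      (twistJetι (twist c E) j).app V
        (-((((dualHomTwist c E (hodgeSheaf X j)).app V ((twistMap c (twistJetπ E j)).app V s) :
            (dual (twist c E)).over V ⟶ (hodgeSheaf X j).over V) ≫ wedgeHomAt j (dlogForm c x y V kx.le ky.le) :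
            (dual (twist c E)).over V ⟶ (hodgeSheaf X (j + 1)).over V))) := by
  have hxV : V ≤ c.U x := kx.le
  have hyV : V ≤ c.U y := ky.le
  -- the `x`-coordinate `p` of `s` and `π⟨c⟩ s = p.fst ⊗ t_x`
  have hπ : (twistMap c (twistJetπ E j)).app V s =
      trivSection c (twistHodge E j) x hxV
        (TwistJetSections.fst (coordAt c (twistJetModule E j) x hxV s : TwistJetSections E j V)) := by
    conv_lhs => rw [← trivSection_coordAt c (twistJetModule E j) x hxV s, twistMap_app_trivSection]
    rfl
  rw [appLE_jetCompare, appLE_jetCompare, coordAt_eq_smul c (twistJetModule E j) x y hxV hyV s, twistJetι_app_apply, hπ]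
  refine TwistJetSections.ext ?_ ?_
  · change (jetTwistFunHigher c E j y hyV _).fst - (jetTwistFunHigher c E j x hxV _).fst = _
    rw [jetTwistFunHigher_fst, jetTwistFunHigher_fst, fst_smul_sectionsHigher,
      ← trivSection_eq_trivSection_smul_hom c x y hxV hyV, sub_self, TwistJetSections.fst_mk]
  · change (jetTwistFunHigher c E j y hyV _).snd - (jetTwistFunHigher c E j x hxV _).snd = _
    rw [jetTwistFunHigher_snd, jetTwistFunHigher_snd, snd_smul_sectionsHigher, trivSection_add_hom, map_add,
      ← trivSection_eq_trivSection_smul_hom c x y hxV hyV, add_sub_cancel_left, wedgeD_eq_comp_wedgeHomAt,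
      dualHomTwist_app_trivSection_comp_id, trivSection_eq_trivSection_smul_hom c y x hyV hxV, trivSection_smul_hom,
      Scheme.Modules.Hom.app_smul, TwistJetSections.snd_mk, dlogForm, wedgeHomAt_neg, Preadditive.comp_neg, neg_neg,
      wedgeHomAt_smul, comp_smul_overHom, smul_comp_overHom]

/-- **`α_y| - α_x| = (π_j⟨c⟩ ≫ λ_j)| ≫ w_{xy} ≫ ι′_j|`** on `V ⊆ U_x ∩ U_y`, `w =` the `dlog`-wedge cocycle of `E⟨c⟩`: the
hypothesis of the extension-comparison lemma. [cite: Atiyah1957, §4 and Prop. 12] -/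
theorem jetCompare_sub (x y : X.left) (V : X.left.Opens) (hx : V ≤ c.U x) (hy : V ≤ c.U y) :
    restrictHom (homOfLE hy) (jetCompare c E j y) - restrictHom (homOfLE hx) (jetCompare c E j x) =
      (SheafOfModules.overFunctor _ V).map (twistMap c (twistJetπ E j) ≫ dualHomTwist c E (hodgeSheaf X j)) ≫
        (dlogWedgeCocycle c j (twist c E)).w x y V hx hy ≫
          (SheafOfModules.overFunctor _ V).map (twistJetι (twist c E) j) :=
  hom_ext_of_appLE fun W k s => by
    rw [appLE_sub_left, appLE_restrictHom, appLE_restrictHom, appLE_jetCompare_sub, appLE_comp, appLE_comp,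
      appLE_over_map, appLE_over_map, dlogWedgeCocycle_w, Scheme.Modules.Hom.comp_app, CategoryTheory.comp_apply]
    congr 1
    change _ = ((_ ≫ restrictHom k (wedgeHomAt j (-(dlogForm c x y V hx hy))) :
      (dual (twist c E)).over W ⟶ (hodgeSheaf X (j + 1)).over W))
    rw [restrictHom_wedgeHomAt, map_neg, map_dlogForm, wedgeHomAt_neg, Preadditive.comp_neg]

/-! ### Naturality in the module -/

variable {E} {E' : X.left.Modules}

/-- **`α_x` is natural in `E`**: `(Pʲ(g))⟨c⟩| ≫ α^{E′}_x = α^{E}_x ≫ Pʲ(g⟨c⟩)|` for `g : E → E′` (`t_x` is natural,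
`λ` is natural in the module — `twistMap_twistMap_comp_dualHomTwist`). [folklore] -/
theorem jetCompare_naturality (g : E ⟶ E') (x : X.left) :
    (SheafOfModules.overFunctor _ (c.U x)).map (twistMap c (twistJetMap g j)) ≫ jetCompare c E' j x =
      jetCompare c E j x ≫ (SheafOfModules.overFunctor _ (c.U x)).map (twistJetMap (twistMap c g) j) := by
  refine hom_ext_of_appLE fun V k s => ?_
  rw [appLE_comp, appLE_over_map, appLE_jetCompare, appLE_comp, appLE_jetCompare, appLE_over_map]
  conv_lhs => rw [← trivSection_coordAt c (twistJetModule E j) x k.le s, twistMap_app_trivSection, coordAt_trivSection]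
  have nat : ∀ (G : X.left.Modules) (φ : Γ(sheafHom (dual E) G, V)),
      (dualHomTwist c E' G).app V (trivSection c (sheafHom (dual E') G) x k.le
        ((Summit.HodgeConjecture.HodgeConjecture.Theorems.PadicPridhamSemiregularity.twistMap g G).app V φ)) =
      (Summit.HodgeConjecture.HodgeConjecture.Theorems.PadicPridhamSemiregularity.twistMap (twistMap c g) G).app V
        ((dualHomTwist c E G).app V (trivSection c (sheafHom (dual E) G) x k.le φ)) := fun G φ => by
    rw [← twistMap_app_trivSection, ← CategoryTheory.comp_apply, ← Scheme.Modules.Hom.comp_app,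
      twistMap_twistMap_comp_dualHomTwist, Scheme.Modules.Hom.comp_app, CategoryTheory.comp_apply]
  refine TwistJetSections.ext ?_ ?_
  · rw [jetTwistFunHigher_fst]
    change (dualHomTwist c E' (hodgeSheaf X j)).app V (trivSection c (twistHodge E' j) x _
      (TwistJetSections.fst ((twistJetMap g j).app V _ : TwistJetSections E' j V))) =
      TwistJetSections.fst ((twistJetMap (twistMap c g) j).app V (jetTwistFunHigher c E j x _ _) :
        TwistJetSections (twist c E') j V)
    rw [twistJetMap_app_apply, twistJetMap_app_apply, TwistJetSections.fst_mk, TwistJetSections.fst_mk,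
      jetTwistFunHigher_fst]
    exact nat _ _
  · rw [jetTwistFunHigher_snd]
    change (dualHomTwist c E' (hodgeSheaf X (j + 1))).app V (trivSection c (twistHodge E' (j + 1)) x _
      (TwistJetSections.snd ((twistJetMap g j).app V _ : TwistJetSections E' j V))) =
      TwistJetSections.snd ((twistJetMap (twistMap c g) j).app V (jetTwistFunHigher c E j x _ _) :
        TwistJetSections (twist c E') j V)
    rw [twistJetMap_app_apply, twistJetMap_app_apply, TwistJetSections.snd_mk, TwistJetSections.snd_mk,
      jetTwistFunHigher_snd]
    exact nat _ _

end CocycleTwist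

end Summit.Ventures.HSemireg

end
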